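import Summits.ValiantsHypothesis.ValiantsHypothesis.Theorems.NewtonUnitEquationsTwoProductsExpBlockShallowHalving

/-!
# K10 `exp-block-tensorisation` — PRICE P1 PAID: `shallowQ_holds : ShallowQ` (shallow Theorem Q for the exponential block tensor)

Instantiation of the abstract halving bound `ncard_cshadow_shallow_le` (`…ExpBlockShallowHalving`) at `ι = Fin b`, all blocks, level frames
`blockFrameR`, columns `expCol` (one factor per block), budget `m`, `k = 2m` columns: the configuration shadow of `shallowConfig A blk m` has at
most `(s+2)·((m+1)·8(2m+2)³)^⌈log₂ b⌉` points — val-idea-37 g2's `ShallowQ` (Sketch v3 text, appended verbatim to `…ExpBlockTensor`), the price P1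
of val-idea-crit-8 g2's VERDICT #13.  (Neither `ShallowGraded` nor the tails' normalisation is used by the count.)
Helper mode (`--supports stmt-ValiantsHypothesis-5906 --as helper`).  HONEST LABEL: a counting statement; the bridge `ShallowVisible` (visible points
lie in this shadow under `ShallowGraded`) and hence `BlockShallowQuasiPoly` remain TARGETS; nothing here closes 5906 or 5905; VP ≠ VNP is NOT proved.
No instances, no notation, no named facts. [folklore]
-/

noncomputable section
set_option linter.dupNamespace false

namespace Summit.ValiantsHypothesis.ValiantsHypothesis.Theorems.NewtonUnitEquations.TwoProducts.ExpBlock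

open MvPolynomial Finset
open Summit.ValiantsHypothesis.ValiantsHypothesis.Theorems.NewtonUnitEquations.TwoProducts.FormalLogLinearisation
open Summit.ValiantsHypothesis.ValiantsHypothesis.Theorems.NewtonUnitEquationsDissociatedUniform

/-- The block frame is the union of its levels. [folklore] -/
theorem blockFrame_eq_biUnion {b : ℕ} (A : Finset Expo) (blk : Expo → Fin b) (m : ℕ) (B : Fin b) :
    blockFrame A blk m B = (Finset.range (m + 1)).biUnion (fun r => blockFrameR A blk r B) := rfl

/-- The K10 shallow configuration is the abstract one over all blocks with level frames `blockFrameR`. [folklore] -/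
theorem shallowConfig_eq_shallowCfg {b : ℕ} (A : Finset Expo) (blk : Expo → Fin b) (m : ℕ) :
    shallowConfig A blk m = shallowCfg (fun B r => blockFrameR A blk r B) Finset.univ m := by
  classical
  ext a
  unfold shallowConfig shallowCfg
  simp only [Finset.mem_filter, Fintype.mem_piFinset, Finset.mem_univ, if_true, forall_true_left, blockFrame_eq_biUnion]

/-- The K10 Khatri–Rao columns are the abstract block-product columns. [folklore] -/
theorem expCol_eq_colS {m b : ℕ} (blk : Expo → Fin b) (u v : Fin m → MvPolynomial (Fin 2) ℂ) :
    expCol blk u v = colS (fun B e i => coeff e (truncExp m (restrictBlock blk B (Fin.append u v i)))) Finset.univ := by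
  funext a i
  simp [expCol, colS]

/-- ★ **K10 PRICE P1 — `shallowQ_holds : ShallowQ`** (val-idea-37 g2's shallow Theorem Q; the configuration shadow of the shallow configuration of
an alphabet with `b` blocks and block frames of size `≤ s` has `≤ (s+2)·((m+1)·8(2m+2)³)^⌈log₂ b⌉` points). [folklore] -/
theorem shallowQ_holds : ShallowQ := by
  intro m b s u v A blk _ _ _ hs
  classical
  have hσ : ∀ B, ((Finset.range (m + 1)).biUnion (fun r => blockFrameR A blk r B)).card ≤ s := fun B => by
    rw [← blockFrame_eq_biUnion]; exact hs B
  have h := ncard_cshadow_shallow_le (fun B r => blockFrameR A blk r B)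
    (fun B e i => coeff e (truncExp m (restrictBlock blk B (Fin.append u v i)))) m s hσ b Finset.univ (by simp) m le_rfl
  rw [← shallowConfig_eq_shallowCfg, ← expCol_eq_colS] at h
  have hX : (XS (Finset.univ : Finset (Fin b)) : (Fin b → Expo) → ℝ) =
      fun a => ((((∑ B, a B) (0 : Fin 2)) : ℕ) : ℝ) := by funext a; rfl
  have hY : (YS (Finset.univ : Finset (Fin b)) : (Fin b → Expo) → ℝ) =
      fun a => ((((∑ B, a B) (1 : Fin 2)) : ℕ) : ℝ) := by funext a; rfl
  rw [hX, hY] at h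
  exact h

end Summit.ValiantsHypothesis.ValiantsHypothesis.Theorems.NewtonUnitEquations.TwoProducts.ExpBlock

end
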